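import Literature.MathematicalPhysics.QuantumFieldTheory.MullerSchiemann1987.MS87Eq517FirstLine
import Literature.MathematicalPhysics.QuantumFieldTheory.MullerSchiemann1987.MS87SmallFieldInputs
import HarnessLib

/-!
# Müller–Schiemann, *Continuum limit of a hierarchical SU(2) lattice gauge theory in 4 dimensions*
# (CMP 110, 1987), (5.17) FIRST LINE p.276 «With (4.53) and (5.15), (5.16) follows for J⁽¹⁾» — ITS POINTWISE
# CONTENT DIRECTLY FROM (A₃) AND THE SMALL-FIELD REGIONS `χ₁χ₂`: the regime hypotheses and the (4.53) modulus bounds of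
# the sibling `MS87Eq517FirstLine` DISCHARGED by `MS87SmallFieldInputs`, every `𝒪` explicit — PROVED
# (theorems only; no definition, no named fact)

statement-level skeleton of published theorems with citation tags; proofs where landed; nothing here is a claim about the Yang–Mills mass gap

[MullerSchiemann1987] V. F. Müller, J. Schiemann, Commun. Math. Phys. **110** (1987) 261–286, Sect. 5 p.276 (5.6)–(5.9),
(5.11), (5.15)–(5.17); Sect. 3 p.267 (A₃); (2.18) p.265. Read by this seat on its own 3× page renders of the journal scan
(`renders-cmp110ms/`, p.276 = PDF 16, p.267 = PDF 7). Lean lane of the lit-balaban YM LIT SWEEP CONTEXT row X1 (register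
`MullerSchiemann1987/`); the model is the `d = 4` HIERARCHICAL `SU(2)` gauge model (Migdal's recursion), NOT lattice
Yang–Mills. Siblings: `MS87Eq517FirstLine` (`eq517_pointwise_y`: the pointwise bound behind the first line of (5.17)
GIVEN the regime `(1 − w₀) + (y/2)² ≤ ¼` and (4.53) in modulus form for both factors) and `MS87SmallFieldInputs`
(`s_le`: the regime from `|θ_j²| < β^{−2α}`; `eq453_norm_le`: (4.53) from (A₃); `norm_le_iff_norm_sq_le`).
THIS FILE composes them: the first line of (5.17), pointwise in `v`, from (A₃) and `χ₁χ₂ = 1` alone.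

**What the paper prints (p.276).** *«χ₁ := χ(uv⁻¹; (i/2)y, β^{−α}), (5.6) χ₂ := χ(v; (i/2)y, β^{−α}), (5.7) … θ₁² :=
θ²(uv⁻¹, (i/2)y), (5.8) θ₂² := θ²(v, (i/2)y), (5.9) … J⁽¹⁾ := ∫dv χ₁χ₂ h(θ₁)h(θ₂), (5.11) … In writing this
decomposition we used in the small field region |θ²| < β^{−2α} the representation for g̃ given in Proposition 1. In
this region we can use (4.53). From the definition (2.13) we deduce for |θ_j²| < β^{−2α}, j = 1, 2, and |y| < ½κ(β′)^{−α},
Re θ₁² = 2[1 − (uv⁻¹)₀] − ¼y² + 𝒪(β^{−4α}), (5.15) Re θ₂² = 2[1 − v₀] − ¼y² + 𝒪(β^{−4α}). (5.16) We now derive upper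
bounds on the individual terms of the decomposition (5.10). With (4.53) and (5.15), (5.16) follows for J⁽¹⁾,
|J⁽¹⁾| < exp{(β/2)y² + 𝒪(β^{1−4α})} ∫dv χ₁χ₂ exp{−2β[2 − (uv⁻¹)₀ − v₀]} (5.17)»*.

**What this file proves (kernel-checked, 0 sorry, standard axioms; theorems only, no definition, no named fact).**
`eq517_first_line_pointwise`: for `uv⁻¹, v ∈ 𝒢[(i/2)y, β^{−α}]` (`χ₁χ₂ = 1`), `|y/2| < ¼`, `(y/2)² ≤ (κ/2)²β^{−2α}`,
`Aβ^{−2α} ≤ ¼` (`A = 53/96 + κ²/2`), `β ≥ 1`, `α ≥ 0`, and the two factors given by (A₃) — `F_j = e^{−V_j}`,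
`V_j = βθ_j² + ½λθ_j⁴ + ⅓σθ_j⁶ + Ṽ_j` with `θ_j² = θ²(·, (i/2)y)` ((5.8)/(5.9)), `|Ṽ_j| ≤ Dβ^{−2}`, `|λ| ≤ c_λβ`,
`|σ| ≤ c_σβ` —
**`|F₁F₂| ≤ exp{(β/2)y² + 14A²β^{1−4α} + 2((½c_λ + ⅓c_σ)β^{1−4α} + Dβ^{−2})}·exp{−2β[2 − (uv⁻¹)₀ − v₀]}`**, i.e. the
integrand bound of (5.17)'s first line with its `𝒪(β^{1−4α})` explicit.

**Readings / scope (declared).** (i) As in the siblings, `λ, σ, Ṽ_j` are letters constrained by (A₃); `θ_j` is any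
complex number with `θ_j² = θ²(·, (i/2)y)` (only `θ_j²` matters). (ii) The `v`-integral and the Bessel-function lines of
(5.17) are the sibling `MS87NonperturbativeBound`'s and are not repeated.

**Not claimed.** (5.17) beyond its first line, (5.21)–(5.25), Theorem 1, anything about lattice Yang–Mills or the Clay
problem.
-/

open Complex

namespace Literature.MathematicalPhysics.QuantumFieldTheory

namespace MullerSchiemann1987

namespace Eq517FromA3

open HeatKernel (u0)
open CentralAngle (thetaSq)
open Theorem2Part3 (regionG mem_regionG)
open SmallFieldInputs (s_le eq453_norm_le norm_le_iff_norm_sq_le)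
open Eq517FirstLine (eq517_pointwise_y)

/-- `(β^{−α})⁴ = β^{−4α}`, `β·β^{−4α} = β^{1−4α}`. [folklore] -/
private theorem rpow_bookkeeping {β α : ℝ} (hβ : 0 < β) :
    (β ^ (-α)) ^ 4 = β ^ (-(4 * α)) ∧ β * β ^ (-(4 * α)) = β ^ (1 - 4 * α) := by
  refine ⟨by rw [← Real.rpow_natCast, ← Real.rpow_mul hβ.le]; ring_nf, ?_⟩
  rw [sub_eq_add_neg, Real.rpow_add hβ, Real.rpow_one]

/-- **THE FIRST LINE OF (5.17), POINTWISE IN `v`, FROM (A₃) AND `χ₁χ₂ = 1`**: see the module docstring for the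
statement; the regime hypotheses `(1 − w₀) + (y/2)² ≤ ¼` of the sibling's `eq517_pointwise_y` come from
`SmallFieldInputs.s_le` (membership in `𝒢[(i/2)y, β^{−α}]`), its (4.53) modulus bounds from `SmallFieldInputs.eq453_norm_le`,
and the two `7β((1 − w₀) + (y/2)²)²` are at most `7A²β^{1−4α}` each. [cite: MullerSchiemann1987, (5.17) first line p.276; (5.6)–(5.9), (5.15)–(5.16) p.276; (A₃) p.267] -/
theorem eq517_first_line_pointwise (u v : Matrix.specialUnitaryGroup (Fin 2) ℂ) {y β α κ D cl cs : ℝ}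
    {F₁ F₂ V₁ V₂ Vt₁ Vt₂ lam sig θ₁ θ₂ : ℂ} (hβ : 1 ≤ β) (hα : 0 ≤ α) (hy : |y / 2| < 1 / 4)
    (hyκ : (y / 2) ^ 2 ≤ (κ / 2) ^ 2 * (β ^ (-α)) ^ 2) (hsmall : (53 / 96 + κ ^ 2 / 2) * (β ^ (-α)) ^ 2 ≤ 1 / 4)
    (hχ₁ : u * v⁻¹ ∈ regionG (((y / 2 : ℝ) : ℂ) * I) (β ^ (-α)))
    (hχ₂ : v ∈ regionG (((y / 2 : ℝ) : ℂ) * I) (β ^ (-α)))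
    (hθ₁ : θ₁ ^ 2 = thetaSq (u * v⁻¹) (((y / 2 : ℝ) : ℂ) * I)) (hθ₂ : θ₂ ^ 2 = thetaSq v (((y / 2 : ℝ) : ℂ) * I))
    (hF₁ : F₁ = Complex.exp (-V₁)) (hV₁ : V₁ = β * θ₁ ^ 2 + lam / 2 * θ₁ ^ 4 + sig / 3 * θ₁ ^ 6 + Vt₁)
    (hF₂ : F₂ = Complex.exp (-V₂)) (hV₂ : V₂ = β * θ₂ ^ 2 + lam / 2 * θ₂ ^ 4 + sig / 3 * θ₂ ^ 6 + Vt₂)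
    (hVt₁ : ‖Vt₁‖ ≤ D * β ^ (-(2:ℝ))) (hVt₂ : ‖Vt₂‖ ≤ D * β ^ (-(2:ℝ))) (hlam : ‖lam‖ ≤ cl * β)
    (hsig : ‖sig‖ ≤ cs * β) :
    ‖F₁ * F₂‖ ≤ Real.exp (β / 2 * y ^ 2 + (14 * (53 / 96 + κ ^ 2 / 2) ^ 2 * β ^ (1 - 4 * α) +
        2 * ((cl / 2 + cs / 3) * β ^ (1 - 4 * α) + D * β ^ (-(2:ℝ))))) *
      Real.exp (-2 * β * (2 - u0 (u * v⁻¹) - u0 v)) := by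
  have hβ0 : 0 < β := by linarith
  obtain ⟨hρ4, hβ4⟩ := rpow_bookkeeping (α := α) hβ0
  have hρ0 : 0 ≤ β ^ (-α) := Real.rpow_nonneg hβ0.le _
  have hρ1 : (β ^ (-α)) ^ 2 ≤ 1 := by
    have h1 : β ^ (-α) ≤ 1 := Real.rpow_le_one_of_one_le_of_nonpos hβ (by linarith)
    nlinarith
  obtain ⟨h1pos, h1Θ⟩ := mem_regionG.mp hχ₁
  obtain ⟨h2pos, h2Θ⟩ := mem_regionG.mp hχ₂
  -- the regime of (5.15)/(5.16) for both factors
  have hs₁ := s_le (u * v⁻¹) (by linarith) hy h1Θ.le hρ1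
  have hs₂ := s_le v (by linarith) hy h2Θ.le hρ1
  have hs₁A : (1 - u0 (u * v⁻¹)) + (y / 2) ^ 2 ≤ (53 / 96 + κ ^ 2 / 2) * (β ^ (-α)) ^ 2 := by linarith
  have hs₂A : (1 - u0 v) + (y / 2) ^ 2 ≤ (53 / 96 + κ ^ 2 / 2) * (β ^ (-α)) ^ 2 := by linarith
  have hs₁4 : (1 - u0 (u * v⁻¹)) + (y / 2) ^ 2 ≤ 1 / 4 := hs₁A.trans hsmall
  have hs₂4 : (1 - u0 v) + (y / 2) ^ 2 ≤ 1 / 4 := hs₂A.trans hsmall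
  -- (4.53) in modulus for both factors (`|θ_j| ≤ β^{−α}` from `|θ_j²| < β^{−2α}`)
  have hn₁ : ‖θ₁‖ ≤ β ^ (-α) := (norm_le_iff_norm_sq_le hρ0).mpr (by rw [hθ₁]; exact h1Θ.le)
  have hn₂ : ‖θ₂‖ ≤ β ^ (-α) := (norm_le_iff_norm_sq_le hρ0).mpr (by rw [hθ₂]; exact h2Θ.le)
  have h453₁ := eq453_norm_le hβ hα hF₁ hV₁ hVt₁ hlam hsig hn₁
  have h453₂ := eq453_norm_le hβ hα hF₂ hV₂ hVt₂ hlam hsig hn₂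
  rw [hθ₁] at h453₁
  rw [hθ₂] at h453₂
  set E := (cl / 2 + cs / 3) * β ^ (1 - 4 * α) + D * β ^ (-(2:ℝ)) with hE
  have h1' : ‖F₁‖ ≤ Real.exp (-β * (thetaSq (u * v⁻¹) (((y / 2 : ℝ) : ℂ) * I)).re + E) := by
    rw [show -β * (thetaSq (u * v⁻¹) (((y / 2 : ℝ) : ℂ) * I)).re + E =
      -(β * (thetaSq (u * v⁻¹) (((y / 2 : ℝ) : ℂ) * I)).re) + E by ring]
    exact h453₁
  have h2' : ‖F₂‖ ≤ Real.exp (-β * (thetaSq v (((y / 2 : ℝ) : ℂ) * I)).re + E) := by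
    rw [show -β * (thetaSq v (((y / 2 : ℝ) : ℂ) * I)).re + E = -(β * (thetaSq v (((y / 2 : ℝ) : ℂ) * I)).re) + E by ring]
    exact h453₂
  -- the sibling's pointwise (5.17), then absorb the two quartic error terms
  have h := eq517_pointwise_y u v hβ0.le hs₁4 hs₂4 h1' h2'
  refine h.trans (mul_le_mul_of_nonneg_right (Real.exp_le_exp.mpr ?_) (Real.exp_pos _).le)
  have hu₁ := abs_le.mp (HeatKernel.abs_u0_le_one (u * v⁻¹))
  have hu₂ := abs_le.mp (HeatKernel.abs_u0_le_one v)
  have hs₁0 : 0 ≤ (1 - u0 (u * v⁻¹)) + (y / 2) ^ 2 := add_nonneg (by linarith) (sq_nonneg _)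
  have hs₂0 : 0 ≤ (1 - u0 v) + (y / 2) ^ 2 := add_nonneg (by linarith) (sq_nonneg _)
  have q₁ : ((1 - u0 (u * v⁻¹)) + (y / 2) ^ 2) ^ 2 ≤ ((53 / 96 + κ ^ 2 / 2) * (β ^ (-α)) ^ 2) ^ 2 :=
    pow_le_pow_left₀ hs₁0 hs₁A 2
  have q₂ : ((1 - u0 v) + (y / 2) ^ 2) ^ 2 ≤ ((53 / 96 + κ ^ 2 / 2) * (β ^ (-α)) ^ 2) ^ 2 :=
    pow_le_pow_left₀ hs₂0 hs₂A 2
  have m₁ := mul_le_mul_of_nonneg_left q₁ (by linarith : 0 ≤ 7 * β)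
  have m₂ := mul_le_mul_of_nonneg_left q₂ (by linarith : 0 ≤ 7 * β)
  have e : 7 * β * ((53 / 96 + κ ^ 2 / 2) * (β ^ (-α)) ^ 2) ^ 2 =
      7 * (53 / 96 + κ ^ 2 / 2) ^ 2 * (β * (β ^ (-α)) ^ 4) := by ring
  rw [e, hρ4, hβ4] at m₁ m₂
  linarith

end Eq517FromA3

end MullerSchiemann1987

end Literature.MathematicalPhysics.QuantumFieldTheory
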